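import Literature.Computability.Cryptography.InaccessibleEntropyUOWHF
import HarnessLib

/-!
# UOWHF from inaccessible entropy: the normalised single-candidate bound (HHRVW 2020, Thm. 5.1, Steps 1–4 with the residuals evaluated)

Topic `Literature/Computability/Cryptography`; seventh file of the "one-way functions ⇒ universal one-way hash
functions" line (Rompel 1990 = Goldreich 2004, Thm. 6.4.29, via Haitner–Holenstein–Reingold–Vadhan–Wee,
*Inaccessible Entropy II*, Theory of Computing 16(8), 2020; plan in `InaccessibleEntropyPrefixHash.lean`). It
turns the counting inequality `CandData.card_tcr_le` (`InaccessibleEntropyUOWHF.lean`) into the bound the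
asymptotic argument consumes, by evaluating the three residual counts with the residual lemmas of that file
and dividing by the number of coin tuples:

* **`CandData.tcr_prob_le`** — for every two-stage adversary `(x₀, A)` against the keyed family
  `G_y(x) = F₃(e(y + x))` of a candidate whose input hash is pairwise and three-wise independent and whose
  output hash is pairwise independent and shrinks by at most one bit, and for thresholds `B ≥ 2^{t·accEntropy +
  tη·log₂|𝒟|}` (accessible side) and `2 ≤ N_thr ≤ 2^{t·realEntropy − tη·log₂|𝒟|}` (real side),

  `Pr[designated collision] ≤ T·invSum(advA0)/(|𝒳|²·M·|Ω₀|) + 3·exp(−2tη²) + max(B,1)/|R₂| + 12·|R₂|/(N_thr − 1)`,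

  `|Ω₀| = t·|𝒟|ᵗ·|G₂||G₃||Ρ||Ω|` being the coin space of the inverter of Claim 4.6 run on `advA0` (so the first
  term is `T·t` times its success probability). With the grid value `k ∈ [realEntropy, realEntropy + Δ/4]`
  (`Δ` the gap of Theorem 4.5, `accEntropy_add_le_realEntropy`) one may take `η = Δ/(4 log₂|𝒟|)`,
  `B ≈ 2^{t(k−3Δ/4)}`, `N_thr ≈ 2^{t(k−Δ/2)}`, `|R₂| ≈ 2^{t(k−Δ/2) − tΔ/8}`, making every residual `2^{−Ω(tΔ)}` or
  `exp(−2tη²)` — the machine-level files fix these as functions of the security parameter.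

Proved; no named facts; no machines.

## References

* I. Haitner, T. Holenstein, O. Reingold, S. Vadhan, H. Wee, *Inaccessible Entropy II: IE Functions and Universal
  One-Way Hashing*, Theory of Computing 16(8) (2020), proof of Thm. 5.1, Steps 1–4 (pp. 30–31), Lemmas 5.3–5.6,
  Claim 4.6.
-/

namespace Literature.Computability.Cryptography

namespace HHRVW

open Finset Real LeftoverHash

namespace CandData

variable {𝒳 𝒴 𝒦 P G₂ R₂ G₃ R₃ D : Type*} {M t : ℕ}
variable [Fintype 𝒳] [DecidableEq 𝒳] [DecidableEq 𝒴] [Fintype 𝒦] [DecidableEq 𝒦] [Fintype P] [DecidableEq P]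
variable [Fintype G₂] [DecidableEq G₂] [Fintype R₂] [DecidableEq R₂] [Fintype G₃] [DecidableEq G₃]
  [Fintype R₃] [DecidableEq R₃] [Fintype D] [DecidableEq D] [AddCommGroup D]
variable {Ρ Ω : Type*} [Fintype Ρ] [Fintype Ω] [Nonempty Ρ] [Nonempty Ω]

/-- **The single-candidate bound of Theorem 5.1, normalised** (one input length, every adversary). Under the
independence hypotheses on the three hash families and for thresholds `B` (accessible side,
`B ≥ 2^{t·accEntropy + tη·log₂|𝒟|}`) and `N_thr` (real side, `N_thr ≤ 2^{t·realEntropy − tη·log₂|𝒟|}`), with an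
output hash shrinking by at most one bit (`|Dom F₂| ≤ 2|R₃|`), the designated-collision probability of any
two-stage adversary `(x₀, A)` against `G_y(x) = F₃(e(y+x))` is at most

  `T · invSum(advA0) / (|𝒳|²·M·|Ω₀|) + 3·exp(−2tη²) + max(B,1)/|R₂| + 12·|R₂|/(N_thr − 1)`,

where the first term is `T·t` times the success probability of the inverter of Claim 4.6 run on `advA0`
(`|Ω₀| = t·|𝒟|ᵗ·|G₂||G₃||Ρ||Ω|` its coin space). The grid condition on the entropy estimate `k` enters only
through the existence of such `B`, `N_thr`, `|R₂|` with small residuals (`B ≈ 2^{t(k−3Δ/4)}`,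
`|R₂| ≈ 2^{t(k−Δ/2) − tΔ/8}`, `N_thr ≈ 2^{t(k−Δ/2)}` for `k ∈ [realEntropy, realEntropy + Δ/4]`).
[cite: HaitnerEtAl2020, Thm. 5.1 (proof, Steps 1–4) with Lemmas 5.3–5.6 and Claim 4.6] -/
theorem tcr_prob_le [Nonempty 𝒳] [Nonempty 𝒦] [Nonempty G₂] [Nonempty G₃] (hM : 0 < M) (C : CandData 𝒳 𝒴 𝒦 P G₂ R₂ G₃ R₃ D M t)
    (h2 : PrefixPairwise C.f C.hp M) {T : ℕ} (hT : 0 < T)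
    (hK2 : IsPairwiseIndep (univ : Finset G₂) C.h₂ univ) (hK3 : IsThreewiseIndep (univ : Finset G₂) C.h₂ univ)
    (hK2' : IsPairwiseIndep (univ : Finset G₃) C.h₃ univ)
    (ht : 0 < t) (hD2 : 1 < Fintype.card (𝒳 × 𝒦 × Fin M)) {η : ℝ} (hη : 0 ≤ η)
    {B : ℕ} (hB : (2 : ℝ) ^ (t * accEntropy (baseL C.f C.hp T M) + t * η * Real.logb 2 (Fintype.card (𝒳 × 𝒦 × Fin M))) ≤ B)
    {Nthr : ℕ} (hNthr : 2 ≤ Nthr)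
    (hN : (Nthr : ℝ) ≤ (2 : ℝ) ^ (t * realEntropy (baseF C.f C.hp M) - t * η * Real.logb 2 (Fintype.card (𝒳 × 𝒦 × Fin M))))
    (hR₃ : Fintype.card ((Fin t → 𝒳 × 𝒦 × Fin M) × G₂) ≤ 2 * Fintype.card R₃) (hr₂ : 0 < Fintype.card R₂)
    (x₀ : Ρ → D) (A : D → Ρ → Ω → D) :
    (((univ : Finset (D × Ρ × Ω)).filter fun q =>
        A q.1 q.2.1 q.2.2 ≠ x₀ q.2.1 ∧ C.fam q.1 (A q.1 q.2.1 q.2.2) = C.fam q.1 (x₀ q.2.1)).card : ℝ) /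
        (Fintype.card D * Fintype.card Ρ * Fintype.card Ω) ≤
      T * invSum C.f C.hp M (C.advA0 x₀ A) /
          ((Fintype.card 𝒳 : ℝ) ^ 2 * M * ((Fintype.card (𝒳 × 𝒦 × Fin M) : ℝ) ^ t * Fintype.card G₂ *
            (Fintype.card G₃ * (Fintype.card Ρ * Fintype.card Ω)))) +
        3 * Real.exp (-2 * t * η ^ 2) + (max B 1 : ℕ) / (Fintype.card R₂ : ℝ) +
        12 * Fintype.card R₂ / ((Nthr : ℝ) - 1) := by
  classical
  haveI : Nonempty (𝒳 × 𝒦 × Fin M) := Fintype.card_pos_iff.1 (lt_trans Nat.zero_lt_one hD2)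
  -- positivity of the sizes
  have hX0 : (0 : ℝ) < Fintype.card 𝒳 := by exact_mod_cast Fintype.card_pos
  have hK0 : (0 : ℝ) < Fintype.card 𝒦 := by exact_mod_cast Fintype.card_pos
  have hM0 : (0 : ℝ) < M := by exact_mod_cast hM
  have hDc0 : (0 : ℝ) < Fintype.card (𝒳 × 𝒦 × Fin M) := by exact_mod_cast Fintype.card_pos
  have hg₂0 : (0 : ℝ) < Fintype.card G₂ := by exact_mod_cast Fintype.card_pos
  have hg₃0 : (0 : ℝ) < Fintype.card G₃ := by exact_mod_cast Fintype.card_pos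
  have hP0 : (0 : ℝ) < Fintype.card Ρ := by exact_mod_cast Fintype.card_pos
  have hW0' : (0 : ℝ) < Fintype.card Ω := by exact_mod_cast Fintype.card_pos
  have hr₂0 : (0 : ℝ) < Fintype.card R₂ := by exact_mod_cast hr₂
  have hε0 : 0 ≤ Real.exp (-2 * t * η ^ 2) := (Real.exp_pos _).le
  -- cardinalities of the structured types
  have hcardT : (Fintype.card (Fin t → 𝒳 × 𝒦 × Fin M) : ℝ) = (Fintype.card (𝒳 × 𝒦 × Fin M) : ℝ) ^ t := by
    rw [Fintype.card_fun, Fintype.card_fin]; push_cast; rfl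
  have hcardα₂ : (Fintype.card ((Fin t → 𝒳 × 𝒦 × Fin M) × G₂) : ℝ) =
      (Fintype.card (𝒳 × 𝒦 × Fin M) : ℝ) ^ t * Fintype.card G₂ := by
    rw [Fintype.card_prod]; push_cast; rw [hcardT]
  have hcardD : (Fintype.card D : ℝ) = (Fintype.card (𝒳 × 𝒦 × Fin M) : ℝ) ^ t * Fintype.card G₂ * Fintype.card G₃ := by
    rw [Fintype.card_congr C.e, Fintype.card_prod, Fintype.card_prod]; push_cast; rw [hcardT]
  have hDcXKM : (Fintype.card (𝒳 × 𝒦 × Fin M) : ℝ) = Fintype.card 𝒳 * Fintype.card 𝒦 * M := by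
    rw [Fintype.card_prod, Fintype.card_prod, Fintype.card_fin]; push_cast; ring
  have hDt0 : (0 : ℝ) < (Fintype.card (𝒳 × 𝒦 × Fin M) : ℝ) ^ t := pow_pos hDc0 t
  have hα₂R₃ : (Fintype.card (𝒳 × 𝒦 × Fin M) : ℝ) ^ t * Fintype.card G₂ ≤ 2 * Fintype.card R₃ := by
    rw [← hcardα₂]; exact_mod_cast hR₃
  have hr₃0 : (0 : ℝ) < Fintype.card R₃ := by
    have := mul_pos hDt0 hg₂0
    linarith only [this, hα₂R₃]
  -- the main counting inequality
  set Img := (univ : Finset ((Fin t → 𝒳 × 𝒦 × Fin M) × G₂)).image C.F₂ with hImgdef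
  have hImg : ∀ u, C.F₂ u ∈ Img := fun u => Finset.mem_image_of_mem _ (Finset.mem_univ u)
  have hmain := C.card_tcr_le hM h2 hT B hImg x₀ A
  -- the residual counts
  set S := ((univ : Finset (D × Ρ × Ω)).filter fun q =>
        A q.1 q.2.1 q.2.2 ≠ x₀ q.2.1 ∧ C.fam q.1 (A q.1 q.2.1 q.2.2) = C.fam q.1 (x₀ q.2.1)).card with hSdef
  set Big := ((univ : Finset (Fin t → 𝒳 × 𝒦 × Fin M)).filter
      fun w => B < (piFamily (baseL C.f C.hp T M) t w).card).card with hBig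
  set Bad₂ := ((univ : Finset ((Fin t → 𝒳 × 𝒦 × Fin M) × G₂)).filter fun p =>
      ∃ w' ∈ truncFam (piFamily (baseL C.f C.hp T M) t) B p.1, w' ≠ p.1 ∧ C.h₂ p.2 w' = C.h₂ p.2 p.1).card with hBad₂
  set Bad₃ := ((univ : Finset (((Fin t → 𝒳 × 𝒦 × Fin M) × G₂) × G₃)).filter fun p =>
      ∃ y' ∈ Img, y' ≠ C.F₂ p.1 ∧ C.h₃ p.2 y' = C.h₃ p.2 (C.F₂ p.1)).card with hBad₃
  -- (r1) accessible side
  have hBigR : (Big : ℝ) ≤ Real.exp (-2 * t * η ^ 2) * (Fintype.card (𝒳 × 𝒦 × Fin M) : ℝ) ^ t :=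
    card_large_piFamily_le (card_baseL_pos C.f C.hp T M) ht hη hD2 hB
  -- (r2) designated collisions in the truncated family
  have hBad₂R : (Bad₂ : ℝ) * Fintype.card R₂ ≤ (Fintype.card (𝒳 × 𝒦 × Fin M) : ℝ) ^ t * ((max B 1 : ℕ) : ℝ) * Fintype.card G₂ := by
    have h := card_bad_truncFam_mul_le (piFamily (baseL C.f C.hp T M) t) B hK2
    have h' : (Bad₂ : ℝ) * Fintype.card R₂ ≤ (Fintype.card (Fin t → 𝒳 × 𝒦 × Fin M) : ℝ) * ((max B 1 : ℕ) : ℝ) * Fintype.card G₂ := by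
      exact_mod_cast h
    rwa [hcardT] at h'
  -- (r3) output-hash collisions among images
  have hK2'' : IsPairwiseIndep (univ : Finset G₃) C.h₃ Img :=
    fun x _ x' _ hne y y' => hK2' x (Finset.mem_univ _) x' (Finset.mem_univ _) hne y y'
  have hBad₃R : (Bad₃ : ℝ) * Fintype.card R₃ ≤ ((Fintype.card (𝒳 × 𝒦 × Fin M) : ℝ) ^ t * Fintype.card G₂) * Img.card * Fintype.card G₃ := by
    have h := card_exists_image_collide_mul_le C.F₂ hImg hK2''
    have h' : (Bad₃ : ℝ) * Fintype.card R₃ ≤ (Fintype.card ((Fin t → 𝒳 × 𝒦 × Fin M) × G₂) : ℝ) * Img.card * Fintype.card G₃ := by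
      exact_mod_cast h
    rwa [hcardα₂] at h'
  -- the image of `F₂` is small: light inputs and Chebyshev
  set Nmin : ℕ := (Nthr - 1) / (2 * Fintype.card R₂) + 2 with hNmin
  set Light := ((univ : Finset ((Fin t → 𝒳 × 𝒦 × Fin M) × G₂)).filter fun p =>
      2 * Fintype.card R₂ * (sameHash C.F₁ C.h₂ p.1 p.2).card ≤ Nthr - 1).card with hLight
  set Small := ((univ : Finset (Fin t → 𝒳 × 𝒦 × Fin M)).filter fun w =>
      (fiber univ C.F₁ (C.F₁ w)).card < Nthr).card with hSmall
  have hImgN : Img.card * Nmin ≤ Light * Nmin + Fintype.card ((Fin t → 𝒳 × 𝒦 × Fin M) × G₂) := by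
    have h := card_image_mul_le C.F₂ Nmin
    refine h.trans (Nat.add_le_add_right (Nat.mul_le_mul_right _ (Finset.card_le_card ?_)) _)
    refine Finset.monotone_filter_right _ fun u _ hu => ?_
    by_contra hnl
    have hge := le_card_fiber_hashIn_of_not_light C.F₁ C.h₂ (Nthr := Nthr) (a := u.1) (g := u.2) hnl
    rw [Prod.mk.eta] at hge
    exact absurd hu (not_lt.2 hge)
  have hLightN : Light * (Nthr - 1) ≤ Small * Fintype.card G₂ * (Nthr - 1) +
      Fintype.card (Fin t → 𝒳 × 𝒦 × Fin M) * (4 * Fintype.card R₂ * Fintype.card G₂) :=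
    card_light_hashIn_mul_le C.F₁ hK2 hK3 Nthr
  have hSmallR : (Small : ℝ) ≤ Real.exp (-2 * t * η ^ 2) * (Fintype.card (𝒳 × 𝒦 × Fin M) : ℝ) ^ t :=
    card_small_fiber_prodMap_le (baseF C.f C.hp M) ht hη hD2 hN
  -- real forms
  have hNsub : ((Nthr - 1 : ℕ) : ℝ) = (Nthr : ℝ) - 1 := by
    rw [Nat.cast_sub (by omega)]; simp
  have hN1 : (0 : ℝ) < (Nthr : ℝ) - 1 := by
    have : (2 : ℝ) ≤ Nthr := by exact_mod_cast hNthr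
    linarith only [this]
  have hNminR : ((Nthr : ℝ) - 1) / (2 * Fintype.card R₂) ≤ (Nmin : ℝ) := by
    have key : (((Nthr - 1 : ℕ) : ℝ)) < ((2 * Fintype.card R₂ : ℕ) : ℝ) * ((((Nthr - 1) / (2 * Fintype.card R₂) : ℕ) : ℝ) + 1) := by
      exact_mod_cast Nat.lt_mul_div_succ (Nthr - 1) (Nat.mul_pos Nat.zero_lt_two hr₂)
    rw [hNsub] at key
    push_cast at key
    have h2r : (0 : ℝ) < 2 * Fintype.card R₂ := by linarith only [hr₂0]
    rw [div_le_iff₀ h2r, hNmin]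
    push_cast
    have hq0 : (0 : ℝ) ≤ (((Nthr - 1) / (2 * Fintype.card R₂) : ℕ) : ℝ) := Nat.cast_nonneg _
    nlinarith only [key, hq0, hr₂0]
  have hNmin0 : (0 : ℝ) < Nmin := lt_of_lt_of_le (div_pos hN1 (by linarith only [hr₂0])) hNminR
  have hImgR : (Img.card : ℝ) * Nmin ≤ Light * Nmin + (Fintype.card (𝒳 × 𝒦 × Fin M) : ℝ) ^ t * Fintype.card G₂ := by
    have h' : (Img.card : ℝ) * Nmin ≤ (Light : ℝ) * Nmin + (Fintype.card ((Fin t → 𝒳 × 𝒦 × Fin M) × G₂) : ℝ) := by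
      exact_mod_cast hImgN
    rwa [hcardα₂] at h'
  have hLightR : (Light : ℝ) * ((Nthr : ℝ) - 1) ≤ Small * Fintype.card G₂ * ((Nthr : ℝ) - 1) +
      (Fintype.card (𝒳 × 𝒦 × Fin M) : ℝ) ^ t * (4 * Fintype.card R₂ * Fintype.card G₂) := by
    have h' : (Light : ℝ) * ((Nthr - 1 : ℕ) : ℝ) ≤ (Small : ℝ) * Fintype.card G₂ * ((Nthr - 1 : ℕ) : ℝ) +
        (Fintype.card (Fin t → 𝒳 × 𝒦 × Fin M) : ℝ) * (4 * Fintype.card R₂ * Fintype.card G₂) := by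
      exact_mod_cast hLightN
    rwa [hNsub, hcardT] at h'
  -- abbreviate the real sizes
  generalize hDc : (Fintype.card (𝒳 × 𝒦 × Fin M) : ℝ) = Dc at *
  generalize hg₂ : (Fintype.card G₂ : ℝ) = g₂ at *
  generalize hg₃ : (Fintype.card G₃ : ℝ) = g₃ at *
  generalize hr₂ : (Fintype.card R₂ : ℝ) = r₂ at *
  generalize hr₃ : (Fintype.card R₃ : ℝ) = r₃ at *
  generalize hε : Real.exp (-2 * t * η ^ 2) = ε at *
  generalize hNr : (Nthr : ℝ) - 1 = Nr at *
  generalize hPc : (Fintype.card Ρ : ℝ) = Pc at *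
  generalize hWc : (Fintype.card Ω : ℝ) = Wc at *
  generalize hXc : (Fintype.card 𝒳 : ℝ) = Xc at *
  generalize hKc : (Fintype.card 𝒦 : ℝ) = Kc at *
  generalize hNm : (Nmin : ℝ) = Nm at *
  clear_value Nmin Light Small Big Bad₂ Bad₃ S Img
  -- (a) the light set is a small fraction of `Dom F₂`
  have hDg : 0 < Dc ^ t * g₂ := mul_pos hDt0 hg₂0
  have ha : (Light : ℝ) ≤ (ε + 4 * r₂ / Nr) * (Dc ^ t * g₂) := by
    have h1 : (Light : ℝ) ≤ (Small * g₂ * Nr + Dc ^ t * (4 * r₂ * g₂)) / Nr := by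
      rw [le_div_iff₀ hN1]; exact hLightR
    have h1' : (Small * g₂ * Nr + Dc ^ t * (4 * r₂ * g₂)) / Nr = Small * g₂ + Dc ^ t * g₂ * (4 * r₂ / Nr) := by
      field_simp
    rw [h1'] at h1
    have h2 : (Small : ℝ) * g₂ ≤ ε * Dc ^ t * g₂ := mul_le_mul_of_nonneg_right hSmallR hg₂0.le
    calc (Light : ℝ) ≤ Small * g₂ + Dc ^ t * g₂ * (4 * r₂ / Nr) := h1
      _ ≤ ε * Dc ^ t * g₂ + Dc ^ t * g₂ * (4 * r₂ / Nr) := by linarith only [h2]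
      _ = (ε + 4 * r₂ / Nr) * (Dc ^ t * g₂) := by ring
  -- (b) the image of `F₂` is small
  have hb : (Img.card : ℝ) ≤ (ε + 6 * r₂ / Nr) * (Dc ^ t * g₂) := by
    -- `Img ≤ Light + Dc^t g₂ / Nmin` and `1/Nmin ≤ 2 r₂ / Nr`
    have h2r : (0 : ℝ) < 2 * r₂ := by linarith only [hr₂0]
    have hq : Dc ^ t * g₂ ≤ (Dc ^ t * g₂ * (2 * r₂ / Nr)) * Nm := by
      have h3 : Nr ≤ 2 * r₂ * Nm := by
        have := hNminR
        rw [div_le_iff₀ h2r] at this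
        linarith only [this]
      have h4 : Dc ^ t * g₂ * Nr ≤ Dc ^ t * g₂ * (2 * r₂ * Nm) := mul_le_mul_of_nonneg_left h3 hDg.le
      have h5 : (Dc ^ t * g₂ * (2 * r₂ / Nr)) * Nm * Nr = Dc ^ t * g₂ * (2 * r₂ * Nm) := by
        field_simp
      have h6 : Dc ^ t * g₂ * Nr ≤ (Dc ^ t * g₂ * (2 * r₂ / Nr)) * Nm * Nr := by rw [h5]; exact h4
      exact le_of_mul_le_mul_right h6 hN1
    have h7 : (Img.card : ℝ) * Nm ≤ ((ε + 6 * r₂ / Nr) * (Dc ^ t * g₂)) * Nm := by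
      calc (Img.card : ℝ) * Nm ≤ Light * Nm + Dc ^ t * g₂ := hImgR
        _ ≤ ((ε + 4 * r₂ / Nr) * (Dc ^ t * g₂)) * Nm + (Dc ^ t * g₂ * (2 * r₂ / Nr)) * Nm :=
            add_le_add (mul_le_mul_of_nonneg_right ha hNmin0.le) hq
        _ = ((ε + 6 * r₂ / Nr) * (Dc ^ t * g₂)) * Nm := by ring
    exact le_of_mul_le_mul_right h7 hNmin0
  -- (c) the output-hash residual
  have hc : Pc * Wc * (Bad₃ : ℝ) ≤ (2 * ε + 12 * r₂ / Nr) * (Dc ^ t * g₂ * g₃ * (Pc * Wc)) := by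
    have h1 : (Bad₃ : ℝ) ≤ 2 * Img.card * g₃ := by
      have h2 : (Bad₃ : ℝ) * r₃ ≤ (2 * Img.card * g₃) * r₃ := by
        calc (Bad₃ : ℝ) * r₃ ≤ (Dc ^ t * g₂) * Img.card * g₃ := hBad₃R
          _ ≤ (2 * r₃) * Img.card * g₃ :=
              mul_le_mul_of_nonneg_right (mul_le_mul_of_nonneg_right hα₂R₃ (Nat.cast_nonneg _)) hg₃0.le
          _ = (2 * Img.card * g₃) * r₃ := by ring
      exact le_of_mul_le_mul_right h2 hr₃0
    have h4 : (Bad₃ : ℝ) ≤ (2 * ε + 12 * r₂ / Nr) * (Dc ^ t * g₂ * g₃) := by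
      calc (Bad₃ : ℝ) ≤ 2 * Img.card * g₃ := h1
        _ ≤ 2 * ((ε + 6 * r₂ / Nr) * (Dc ^ t * g₂)) * g₃ := by
            have := mul_le_mul_of_nonneg_right hb hg₃0.le
            linarith only [this]
        _ = (2 * ε + 12 * r₂ / Nr) * (Dc ^ t * g₂ * g₃) := by ring
    have hPW : 0 ≤ Pc * Wc := (mul_pos hP0 hW0').le
    calc Pc * Wc * (Bad₃ : ℝ) ≤ Pc * Wc * ((2 * ε + 12 * r₂ / Nr) * (Dc ^ t * g₂ * g₃)) :=
          mul_le_mul_of_nonneg_left h4 hPW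
      _ = (2 * ε + 12 * r₂ / Nr) * (Dc ^ t * g₂ * g₃ * (Pc * Wc)) := by ring
  -- (d) the input-hash residual
  have hd : g₃ * (Pc * Wc) * (Bad₂ : ℝ) ≤ ((max B 1 : ℕ) / r₂) * (Dc ^ t * g₂ * g₃ * (Pc * Wc)) := by
    have h1 : (Bad₂ : ℝ) ≤ ((max B 1 : ℕ) / r₂) * (Dc ^ t * g₂) := by
      rw [div_mul_eq_mul_div, le_div_iff₀ hr₂0]
      calc (Bad₂ : ℝ) * r₂ ≤ Dc ^ t * ((max B 1 : ℕ) : ℝ) * g₂ := hBad₂R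
        _ = ((max B 1 : ℕ) : ℝ) * (Dc ^ t * g₂) := by ring
    have hpos : 0 ≤ g₃ * (Pc * Wc) := (mul_pos hg₃0 (mul_pos hP0 hW0')).le
    calc g₃ * (Pc * Wc) * (Bad₂ : ℝ) ≤ g₃ * (Pc * Wc) * (((max B 1 : ℕ) / r₂) * (Dc ^ t * g₂)) :=
          mul_le_mul_of_nonneg_left h1 hpos
      _ = ((max B 1 : ℕ) / r₂) * (Dc ^ t * g₂ * g₃ * (Pc * Wc)) := by ring
  -- (e) the accessible residual
  have he : (Big : ℝ) * (g₂ * (g₃ * (Pc * Wc))) ≤ ε * (Dc ^ t * g₂ * g₃ * (Pc * Wc)) := by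
    have hpos : 0 ≤ g₂ * (g₃ * (Pc * Wc)) := (mul_pos hg₂0 (mul_pos hg₃0 (mul_pos hP0 hW0'))).le
    calc (Big : ℝ) * (g₂ * (g₃ * (Pc * Wc))) ≤ (ε * Dc ^ t) * (g₂ * (g₃ * (Pc * Wc))) :=
          mul_le_mul_of_nonneg_right hBigR hpos
      _ = ε * (Dc ^ t * g₂ * g₃ * (Pc * Wc)) := by ring
  -- (f) the inverter term
  have hW0 : 0 < Dc ^ t * g₂ * g₃ * (Pc * Wc) := mul_pos (mul_pos (mul_pos hDt0 hg₂0) hg₃0) (mul_pos hP0 hW0')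
  have hf : (T : ℝ) * Kc * invSum C.f C.hp M (C.advA0 x₀ A) / (Xc * Dc) =
      (T * invSum C.f C.hp M (C.advA0 x₀ A) / (Xc ^ 2 * M * (Dc ^ t * g₂ * (g₃ * (Pc * Wc))))) *
        (Dc ^ t * g₂ * g₃ * (Pc * Wc)) := by
    rw [hDcXKM]
    field_simp
  -- assemble
  have htot : (S : ℝ) ≤ (T * invSum C.f C.hp M (C.advA0 x₀ A) / (Xc ^ 2 * M * (Dc ^ t * g₂ * (g₃ * (Pc * Wc)))) +
        3 * ε + (max B 1 : ℕ) / r₂ + 12 * r₂ / Nr) * (Dc ^ t * g₂ * g₃ * (Pc * Wc)) := by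
    have h0 : (S : ℝ) ≤ T * Kc * invSum C.f C.hp M (C.advA0 x₀ A) / (Xc * Dc) +
        Big * (g₂ * (g₃ * (Pc * Wc))) + g₃ * (Pc * Wc) * Bad₂ + Pc * Wc * Bad₃ := hmain
    rw [hf] at h0
    linarith only [h0, hc, hd, he]
  have hden : (Fintype.card D : ℝ) * Pc * Wc = Dc ^ t * g₂ * g₃ * (Pc * Wc) := by
    rw [hcardD]; ring
  rw [hden, div_le_iff₀ hW0]
  exact htot

end CandData

end HHRVW

end Literature.Computability.Cryptography
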